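import Literature.NumberTheory.GaloisRepresentations.ContinuousCohomologyConnecting
import HarnessLib

/-!
# The kernel of inflation in degree two under a change of coefficients

Let `π : Γ → G` be a quotient homomorphism of topological groups (a continuous open surjection, e.g.
`Γ ↠ Γ/N` for a closed normal subgroup `N`, or `H ↠ H/N_S` for an open `H ≤ Γ_K` containing the
ramification subgroup `N_S`), `X` a topological `G`-module and `f` a continuous inhomogeneous
`2`-cocycle of `G` with values in `X` whose INFLATION `f ∘ (π × π)` to `Γ` is the coboundary `∂φ` of a
continuous `1`-cochain `φ : Γ → X` — i.e. `[f] ∈ ker(inf : H²(G, X) → H²(Γ, X))`.  The five-term exact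
sequence `0 → H¹(G, X) → H¹(Γ, X) → H¹(N, X)^G →(tg) H²(G, X) →(inf) H²(Γ, X)` (Hochschild–Serre;
Neukirch–Schmidt–Wingberg (1.6.7), Serre I §2.6 (b)) says that `[f]` is the transgression of the
`Γ`-invariant homomorphism `x : N → X`, `x(n) = φ(n) − f(1, 1)` (`N = ker π`), and that `[f] = 0` iff
`x` is the restriction of a `1`-cocycle of `Γ`.  This file proves, at the level of cochains and without
spectral sequences, the version of the last clause AFTER A CHANGE OF COEFFICIENTS `ι : X → X'`
(a morphism of topological `G`-modules):

* `transgression_apply_one`, `transgression_mul`, `transgression_mul_right`, `transgression_conj` — the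
  reading lemmas: `φ(1) = f(1,1)`; `x` is additive on `N`; `φ(σn) = φ(σ) + σ·x(n)`;
  `x(σnσ⁻¹) = σ·x(n)` (`Γ`-equivariance of the transgression datum);
* `exists_twoCoboundary_of_oneCocycle_extension` — **if `ι ∘ x` is the restriction to `N` of a
  continuous `1`-cocycle `ψ : Γ → X'`, then `ι ∘ f` is the coboundary of a continuous `1`-cochain of
  `G`** (`χ = ι ∘ (φ − f(1,1)) − ψ` vanishes on `N`, is constant on `N`-cosets by the cocycle
  identities, hence descends CONTINUOUSLY through the quotient map `π`, and `∂χ̄ + ∂(const ι f(1,1)) = ι f`);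
* `cohomologyMap_twoCocycleClass_eq_zero_of_oneCocycle_extension` — the same on classes:
  `H²(ι)[f] = 0` in `H²(G, X')`.

With `ι = id` this is the inclusion `ker(inf) ⊆ im(tg)` half of (1.6.7) read backwards; the point of
the coefficient change is the arithmetic application (`N = Gal(K̄/K_S)`, `X = μ_{p^m} ↪ X' = μ_{p^{m+t}}`:
the transgression datum is a Kummer character of `K_S`, which becomes the restriction of a Kummer
cocycle of the finite level only after raising the level of the roots of unity — the step "(B)" in the
proof of the weak Leopoldt conjecture for the cyclotomic `ℤ_p`-extension, Neukirch–Schmidt–Wingberg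
(10.3.25), via the `S`-ideal class group term of (8.3.11)).  HONEST FRAMING: elementary cochain
calculus for topological groups (textbook, Serre I §2 / NSW I §6); nothing arithmetic is proved here.

## References

* J. Neukirch, A. Schmidt, K. Wingberg, *Cohomology of Number Fields*, 2nd ed. (2008), (1.6.6)–(1.6.7)
  (five-term sequence, transgression), II §7 (continuous cochains). [NeukirchSchmidtWingberg2008]
* J.-P. Serre, *Galois Cohomology* (1997), I §2.2–§2.3 (inhomogeneous continuous cochains), I §2.6 (b).
  [SerreGaloisCohomology1997]
* G. Hochschild, J.-P. Serre, *Cohomology of group extensions*, Trans. AMS 74 (1953) 110–134, §II.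
-/

noncomputable section

open CategoryTheory Function Topology

universe u v

namespace Literature.NumberTheory.GaloisRepresentations

open _root_.TopRep _root_.ContRepresentation _root_.ContinuousCohomology

section Transgression

variable {k : Type u} [CommRing k] [TopologicalSpace k]
variable {Γ : Type v} [Group Γ] [TopologicalSpace Γ]
variable {G : Type v} [Group G] [TopologicalSpace G]
variable (π : Γ →ₜ* G) {X X' : TopRep.{v} k G}

/-- If the inflation of the `2`-cocycle `f` along `π` is the coboundary of `φ`, then **`φ(1) = f(1, 1)`**.
[cite: NeukirchSchmidtWingberg2008, (1.6.6)] -/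
theorem transgression_apply_one (f : contTwoCocycles X) (φ : C(Γ, X))
    (hφ : ∀ σ τ : Γ, f.1 (π σ, π τ) = X.ρ (π σ) (φ τ) - φ (σ * τ) + φ σ) :
    φ 1 = f.1 (1, 1) := by
  have h := hφ 1 1
  rw [map_one, mul_one, _root_.map_one, one_apply_eq_self, sub_add_cancel] at h
  exact h.symm

/-- **The transgression datum `x(n) = φ(n) − f(1,1)` is additive on `N = ker π`** (`N` acts on `X`
through `π`, i.e. trivially). [cite: NeukirchSchmidtWingberg2008, (1.6.6)] -/
theorem transgression_mul (f : contTwoCocycles X) (φ : C(Γ, X))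
    (hφ : ∀ σ τ : Γ, f.1 (π σ, π τ) = X.ρ (π σ) (φ τ) - φ (σ * τ) + φ σ)
    {n n' : Γ} (hn : π n = 1) (hn' : π n' = 1) :
    φ (n * n') - f.1 (1, 1) = (φ n - f.1 (1, 1)) + (φ n' - f.1 (1, 1)) := by
  have h := hφ n n'
  rw [hn, hn', _root_.map_one, one_apply_eq_self] at h
  -- `f(1,1) = φ n' - φ (n n') + φ n`
  rw [h]
  abel

/-- **`φ(σ n) = φ(σ) + σ · x(n)`** for `n ∈ ker π`. [cite: NeukirchSchmidtWingberg2008, (1.6.6)] -/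
theorem transgression_mul_right (f : contTwoCocycles X) (φ : C(Γ, X))
    (hφ : ∀ σ τ : Γ, f.1 (π σ, π τ) = X.ρ (π σ) (φ τ) - φ (σ * τ) + φ σ)
    (σ : Γ) {n : Γ} (hn : π n = 1) :
    φ (σ * n) = φ σ + X.ρ (π σ) (φ n - f.1 (1, 1)) := by
  have h := hφ σ n
  rw [hn, contTwoCocycles.apply_one_right] at h
  rw [map_sub, h]
  abel

/-- **`Γ`-equivariance of the transgression datum: `x(σ n σ⁻¹) = σ · x(n)`** for `n ∈ ker π`
(`H¹(N, X)^G`, the source of the transgression). [cite: NeukirchSchmidtWingberg2008, (1.6.6)–(1.6.7)]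
[cite: SerreGaloisCohomology1997, I §2.6 (b)] -/
theorem transgression_conj (f : contTwoCocycles X) (φ : C(Γ, X))
    (hφ : ∀ σ τ : Γ, f.1 (π σ, π τ) = X.ρ (π σ) (φ τ) - φ (σ * τ) + φ σ)
    (σ : Γ) {n : Γ} (hn : π n = 1) :
    φ (σ * n * σ⁻¹) - f.1 (1, 1) = X.ρ (π σ) (φ n - f.1 (1, 1)) := by
  -- `∂φ (σn, σ⁻¹) = f(πσ, πσ⁻¹) = ∂φ (σ, σ⁻¹)`
  have h1 := hφ (σ * n) σ⁻¹
  have h2 := hφ σ σ⁻¹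
  rw [map_mul, hn, mul_one, transgression_mul_right π f φ hφ σ hn] at h1
  rw [mul_inv_cancel, transgression_apply_one π f φ hφ] at h2
  rw [h2] at h1
  -- `h1 : A - f(1,1) + φ σ = A - φ(σ n σ⁻¹) + (φ σ + σ•x n)`
  have h' := sub_eq_zero.mpr h1
  rw [← sub_eq_zero]
  convert h' using 1
  abel

/-- **Eventual triviality of a class in `ker(inf)` after a change of coefficients — cochain form.**
Let `π : Γ → G` be a topological quotient homomorphism, `ι : X → X'` a morphism of topological
`G`-modules, `f` a continuous `2`-cocycle of `G` in `X` with `f ∘ (π × π) = ∂φ`, and suppose the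
transgression datum pushed to `X'`, `n ↦ ι(φ(n) − f(1,1))` on `ker π`, is the restriction of a
continuous `1`-cocycle `ψ : Γ → X'` (for the action through `π`).  Then `ι ∘ f = ∂b` for a continuous
`1`-cochain `b : G → X'`. [cite: NeukirchSchmidtWingberg2008, (1.6.7)] [cite: SerreGaloisCohomology1997, I §2.6 (b)] -/
theorem exists_twoCoboundary_of_oneCocycle_extension (hq : IsQuotientMap π) (ι : X ⟶ X')
    (f : contTwoCocycles X) (φ : C(Γ, X))
    (hφ : ∀ σ τ : Γ, f.1 (π σ, π τ) = X.ρ (π σ) (φ τ) - φ (σ * τ) + φ σ)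
    (ψ : C(Γ, X')) (hψ : ∀ σ τ : Γ, ψ (σ * τ) = ψ σ + X'.ρ (π σ) (ψ τ))
    (hψN : ∀ n : Γ, π n = 1 → ψ n = ι.hom (φ n - f.1 (1, 1))) :
    ∃ b : C(G, X'), ∀ g h : G, ι.hom (f.1 (g, h)) = X'.ρ g (b h) - b (g * h) + b g := by
  have hsurj : Surjective π := hq.surjective
  -- the cochain `χ = ι ∘ (φ - f(1,1)) - ψ` of `Γ`
  set c : X := f.1 (1, 1) with hc
  let χ : Γ → X' := fun σ => ι.hom (φ σ - c) - ψ σ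
  have hχc : Continuous χ :=
    ((ι.hom.continuous).comp (φ.continuous.sub continuous_const)).sub ψ.continuous
  -- `χ` vanishes on `ker π`
  have hχN : ∀ n : Γ, π n = 1 → χ n = 0 := fun n hn => by
    change ι.hom (φ n - c) - ψ n = 0
    rw [hψN n hn, sub_self]
  -- `∂χ = ι ∘ f ∘ (π × π) - (σ ↦ πσ • ι c)`:  `πσ • χ τ - χ (σ τ) + χ σ = ι (f (πσ, πτ)) - πσ • ι c`
  have hdχ : ∀ σ τ : Γ, X'.ρ (π σ) (χ τ) - χ (σ * τ) + χ σ =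
      ι.hom (f.1 (π σ, π τ)) - X'.ρ (π σ) (ι.hom c) := by
    intro σ τ
    change X'.ρ (π σ) (ι.hom (φ τ - c) - ψ τ) - (ι.hom (φ (σ * τ) - c) - ψ (σ * τ)) +
        (ι.hom (φ σ - c) - ψ σ) = _
    rw [hφ σ τ, hψ σ τ, map_sub, map_sub, map_sub, map_sub, map_sub, map_add, map_sub,
      ← TopRep.hom_comm_apply ι, ← TopRep.hom_comm_apply ι]
    abel
  -- `χ` is constant on the cosets of `ker π`
  have hχcoset : ∀ σ n : Γ, π n = 1 → χ (σ * n) = χ σ := by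
    intro σ n hn
    have h := hdχ σ n
    rw [hn, contTwoCocycles.apply_one_right, TopRep.hom_comm_apply ι, sub_self, hχN n hn,
      map_zero, zero_sub, neg_add_eq_sub, sub_eq_zero] at h
    exact h.symm
  have hwd : ∀ σ σ' : Γ, π σ = π σ' → χ σ = χ σ' := by
    intro σ σ' h
    have hn : π (σ⁻¹ * σ') = 1 := by rw [map_mul, map_inv, h, inv_mul_cancel]
    rw [← hχcoset σ (σ⁻¹ * σ') hn, mul_inv_cancel_left]
  -- the descended cochain `b̄ : G → X'`
  let bf : G → X' := fun g => χ (Classical.choose (hsurj g))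
  have hbf : ∀ σ : Γ, bf (π σ) = χ σ := fun σ => hwd _ _ (Classical.choose_spec (hsurj (π σ)))
  have hbc : Continuous bf := by
    refine hq.continuous_iff.mpr ?_
    have hcomp : bf ∘ π = χ := funext fun σ => hbf σ
    rw [hcomp]
    exact hχc
  -- `b = b̄ + const (ι c)`
  refine ⟨⟨fun g => bf g + ι.hom c, hbc.add continuous_const⟩, fun g h => ?_⟩
  obtain ⟨σ, rfl⟩ := hsurj g
  obtain ⟨τ, rfl⟩ := hsurj h
  change ι.hom (f.1 (π σ, π τ)) = X'.ρ (π σ) (bf (π τ) + ι.hom c) - (bf (π σ * π τ) + ι.hom c) +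
    (bf (π σ) + ι.hom c)
  rw [← map_mul, hbf, hbf, hbf, map_add]
  have h := sub_eq_iff_eq_add.mp (hdχ σ τ).symm
  rw [h]
  abel

/-- **Eventual triviality of a class in `ker(inf)` after a change of coefficients — class form.**
Under the hypotheses of `exists_twoCoboundary_of_oneCocycle_extension` (`G` locally compact, so that
`H²` is computed by inhomogeneous cocycles): `H²(ι)[f] = 0` in `H²(G, X')`.
[cite: NeukirchSchmidtWingberg2008, (1.6.7)] [cite: SerreGaloisCohomology1997, I §2.6 (b)] -/
theorem cohomologyMap_twoCocycleClass_eq_zero_of_oneCocycle_extension [IsTopologicalGroup G]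
    [LocallyCompactSpace G]
    (hq : IsQuotientMap π) (ι : X ⟶ X') (f : contTwoCocycles X) (φ : C(Γ, X))
    (hφ : ∀ σ τ : Γ, f.1 (π σ, π τ) = X.ρ (π σ) (φ τ) - φ (σ * τ) + φ σ)
    (ψ : C(Γ, X')) (hψ : ∀ σ τ : Γ, ψ (σ * τ) = ψ σ + X'.ρ (π σ) (ψ τ))
    (hψN : ∀ n : Γ, π n = 1 → ψ n = ι.hom (φ n - f.1 (1, 1))) :
    cohomologyMap ι 2 (twoCocycleClass X f) = 0 := by
  obtain ⟨b, hb⟩ := exists_twoCoboundary_of_oneCocycle_extension π hq ι f φ hφ ψ hψ hψN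
  rw [cohomologyMap_twoCocycleClass, twoCocycleClass_eq_zero_iff]
  exact ⟨b, fun g h => by rw [pullback₂_id_resIdHom_apply]; exact hb g h⟩

/-- The same with the extension given as a bundled `1`-cocycle of the restricted representation
`res π X'`. [cite: NeukirchSchmidtWingberg2008, (1.6.7)] -/
theorem cohomologyMap_twoCocycleClass_eq_zero_of_oneCocycle_extension' [IsTopologicalGroup G]
    [LocallyCompactSpace G]
    (hq : IsQuotientMap π) (ι : X ⟶ X') (f : contTwoCocycles X) (φ : C(Γ, X))
    (hφ : ∀ σ τ : Γ, f.1 (π σ, π τ) = X.ρ (π σ) (φ τ) - φ (σ * τ) + φ σ)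
    (ψ : contOneCocycles (TopRep.res (π : Γ →* G) X'))
    (hψN : ∀ n : Γ, π n = 1 → ψ.1 n = ι.hom (φ n - f.1 (1, 1))) :
    cohomologyMap ι 2 (twoCocycleClass X f) = 0 :=
  cohomologyMap_twoCocycleClass_eq_zero_of_oneCocycle_extension π hq ι f φ hφ ψ.1
    (fun σ τ => ψ.2 σ τ) hψN

/-- **Converse reading (for completeness): a class killed by inflation has a transgression datum.**
If the inflated cocycle `f ∘ (π × π)` — as a `2`-cocycle of the restricted representation `res π X` —
has trivial class, then `f ∘ (π × π) = ∂φ` for some continuous `φ : Γ → X` (`Γ` locally compact).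
[cite: SerreGaloisCohomology1997, I §2.3] -/
theorem exists_oneCochain_of_inflation_eq_zero [IsTopologicalGroup Γ] [LocallyCompactSpace Γ] (f : contTwoCocycles X)
    (F : contTwoCocycles (TopRep.res (π : Γ →* G) X)) (hF : ∀ σ τ : Γ, F.1 (σ, τ) = f.1 (π σ, π τ))
    (h0 : twoCocycleClass _ F = 0) :
    ∃ φ : C(Γ, X), ∀ σ τ : Γ, f.1 (π σ, π τ) = X.ρ (π σ) (φ τ) - φ (σ * τ) + φ σ := by
  obtain ⟨b, hb⟩ := (twoCocycleClass_eq_zero_iff _ F).1 h0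
  exact ⟨b, fun σ τ => by rw [← hF]; exact hb σ τ⟩

end Transgression

end Literature.NumberTheory.GaloisRepresentations

end
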